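import Literature.Analysis.SegalBargmann.HermiteLadder
import HarnessLib

/-!
# The quadratic oscillator operators on Schwartz space through the Bargmann dictionary (Folland 1989, §1.7, §4.4)

Topic `Analysis/SegalBargmann`; namespace `Literature.Analysis.SegalBargmann`.  Continuation of
`Literature.Analysis.SegalBargmann.HermiteLadder`.  The infinitesimal oscillator (metaplectic) representation acts on
`𝒮(ℝ^σ)` by the QUADRATIC expressions in Folland's `Z_j = X_j + iD_j`, `Z_j^* = X_j − iD_j`; on the Fock side these are
the three families of letters `z_i z_j` (raising), `∂²/∂z_i∂z_j` (lowering) and `z_i ∂/∂z_j + ½δ_{ij}` (the compact part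
`𝔲(n)`, whose diagonal is the torus).  This file proves, on genuine Schwartz functions `B⁻¹F := hermiteSchwartz (binv F)`
(`F ∈ ℂ[z_σ]` a Fock polynomial; `binv` = the inverse Bargmann transform at symbol level, `FockHermite`), the complete
quadratic dictionary:

* §1 mixed and pure products: `Z_i^* Z_j (B⁻¹F) = π⁻¹ B⁻¹(z_i ∂_jF)`, `Z_i Z_j^* (B⁻¹F) = π⁻¹ B⁻¹(z_j ∂_iF + δ_{ij}F)`,
  `Z_i^* Z_j^* (B⁻¹F) = B⁻¹(z_i z_j F)`, `Z_i Z_j (B⁻¹F) = π⁻² B⁻¹(∂_i∂_jF)`;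
* §2 the CANONICAL COMMUTATION RELATIONS on the Hermite span (Folland (1.80)(iv)):
  `(Z_i Z_j^* − Z_j^* Z_i)(B⁻¹F) = π⁻¹ δ_{ij} · B⁻¹F`, and `[Z_i, Z_j] = [Z_i^*, Z_j^*] = 0` there;
* §3 the three LETTERS of the oscillator Lie algebra in Folland's normalisation, as operators on `𝓢(ℝ^σ, ℂ)`:
  `kLetterCLM i j := π Z_i^* Z_j + ½δ_{ij}` ↔ `z_i∂_j + ½δ_{ij}`, `pPlusLetterCLM i j := Z_i^* Z_j^*` ↔ `z_i z_j`,
  `pMinusLetterCLM i j := π² Z_i Z_j` ↔ `∂_i∂_j` (`kLetterCLM_binv`, `pPlusLetterCLM_binv`, `pMinusLetterCLM_binv`);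
  the diagonal `kLetterCLM j j = ½ · hermiteOpCLM j` on the Hermite span (`kLetterCLM_self_hermiteSchwartz`).

Everything is a corollary of `HermiteLadder` §3 and the symbol calculus of `FockHermite`; Mathlib + tree only; no cited
fact is used as a hypothesis.

Motivation (not used in any statement): these are the Lie-algebra-level identities behind "the `K`-finite vectors of
the Schrödinger model of the Weil representation are the Fock polynomials, with `𝔲(n)` acting through `z_i∂_j + ½δ_{ij}`
and the non-compact directions through `z_iz_j`, `∂_i∂_j`" (Folland 1989 Prop. (4.49), §4.4; Adams 2007 §3), i.e. the
object match between a constructed Schrödinger-model action and a printed Fock-model action is checked letter by letter.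

## References

* G. B. Folland, *Harmonic Analysis in Phase Space*, Annals of Mathematics Studies 122, Princeton UP (1989): §1.7
  (1.73)–(1.80) (Bargmann dictionary, commutation relations), Prop. (4.49) / §4.4 (the infinitesimal metaplectic
  representation by quadratic operators).  [cite: Folland1989, §1.7]

## Provenance

Written for the tree under the LEAN-IN-TREE rule (2026-08-18) by the pub-hodgecm formalisation cell (model-construction
sub-cell, seat mc-binder-2).
-/

set_option autoImplicit false

noncomputable section

open MvPolynomial Complex SchwartzMap
open scoped BigOperators Real LineDeriv

namespace Literature.Analysis.SegalBargmann

variable {σ : Type*} [Fintype σ] [DecidableEq σ]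

/-! ## §1  Products of two ladder operators on `B⁻¹F` -/

section Products

/-- **`Z_i^* Z_j (B⁻¹F) = π⁻¹ B⁻¹(z_i ∂_jF)`** (Folland (1.73)–(1.75)). [cite: Folland1989, §1.7] -/
theorem zsCLM_zCLM_binv' (i j : σ) (F : MvPolynomial σ ℂ) :
    zsCLM i (zCLM j (hermiteSchwartz (binv F))) = (π : ℂ)⁻¹ • hermiteSchwartz (binv (X i * pderiv j F)) := by
  rw [zCLM_binv, map_smul, zsCLM_binv]

/-- **`Z_i Z_j^* (B⁻¹F) = π⁻¹ B⁻¹(z_j ∂_iF + δ_{ij} F)`** (Leibniz rule on the Fock side). [cite: Folland1989, §1.7] -/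
theorem zCLM_zsCLM_binv (i j : σ) (F : MvPolynomial σ ℂ) :
    zCLM i (zsCLM j (hermiteSchwartz (binv F))) =
      (π : ℂ)⁻¹ • hermiteSchwartz (binv (X j * pderiv i F + if i = j then F else 0)) := by
  rw [zsCLM_binv, zCLM_binv, pderiv_X_mul]

/-- **Raising: `Z_i^* Z_j^* (B⁻¹F) = B⁻¹(z_i z_j F)`**. [cite: Folland1989, §1.7] -/
theorem zsCLM_zsCLM_binv (i j : σ) (F : MvPolynomial σ ℂ) :
    zsCLM i (zsCLM j (hermiteSchwartz (binv F))) = hermiteSchwartz (binv (X i * (X j * F))) := by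
  rw [zsCLM_binv, zsCLM_binv]

/-- **Lowering: `Z_i Z_j (B⁻¹F) = π⁻² B⁻¹(∂_i ∂_j F)`**. [cite: Folland1989, §1.7] -/
theorem zCLM_zCLM_binv (i j : σ) (F : MvPolynomial σ ℂ) :
    zCLM i (zCLM j (hermiteSchwartz (binv F))) =
      ((π : ℂ)⁻¹ * (π : ℂ)⁻¹) • hermiteSchwartz (binv (pderiv i (pderiv j F))) := by
  rw [zCLM_binv, map_smul, zCLM_binv, smul_smul]

end Products

/-! ## §2  The canonical commutation relations on the Hermite span -/

section CCR

/-- **Folland (1.80)(iv) on the Hermite span: `[Z_i, Z_j^*] = π⁻¹ δ_{ij}`** —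
`Z_i Z_j^* (B⁻¹F) − Z_j^* Z_i (B⁻¹F) = π⁻¹ δ_{ij} · B⁻¹F` for every Fock polynomial `F`. [cite: Folland1989, (1.80)] -/
theorem ccr_binv (i j : σ) (F : MvPolynomial σ ℂ) :
    zCLM i (zsCLM j (hermiteSchwartz (binv F))) - zsCLM j (zCLM i (hermiteSchwartz (binv F))) =
      (if i = j then (π : ℂ)⁻¹ • hermiteSchwartz (binv F) else 0) := by
  rw [zCLM_zsCLM_binv, zsCLM_zCLM_binv', ← smul_sub, map_add, hermiteSchwartz_add, add_sub_cancel_left]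
  split_ifs with h
  · rfl
  · rw [map_zero]
    ext x
    rw [smul_apply, hermiteSchwartz_apply]
    simp [hermiteFun]

/-- On the same index the commutator is the scalar `π⁻¹`: `Z_j Z_j^* (B⁻¹F) = Z_j^* Z_j (B⁻¹F) + π⁻¹ B⁻¹F`.
[cite: Folland1989, (1.80)] -/
theorem zCLM_zsCLM_self_binv (j : σ) (F : MvPolynomial σ ℂ) :
    zCLM j (zsCLM j (hermiteSchwartz (binv F))) =
      zsCLM j (zCLM j (hermiteSchwartz (binv F))) + (π : ℂ)⁻¹ • hermiteSchwartz (binv F) := by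
  have h := ccr_binv j j F
  rw [if_pos rfl] at h
  rw [← h, add_comm, sub_add_cancel]

/-- **`[Z_i^*, Z_j^*] = 0`** on the Hermite span (creation operators commute). [folklore] -/
theorem zsCLM_comm_binv (i j : σ) (F : MvPolynomial σ ℂ) :
    zsCLM i (zsCLM j (hermiteSchwartz (binv F))) = zsCLM j (zsCLM i (hermiteSchwartz (binv F))) := by
  rw [zsCLM_zsCLM_binv, zsCLM_zsCLM_binv, mul_left_comm]

/-- **`[Z_i, Z_j] = 0`** on the Hermite span (annihilation operators commute; symmetry of second partials of
polynomials). [folklore] -/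
theorem zCLM_comm_binv (i j : σ) (F : MvPolynomial σ ℂ) :
    zCLM i (zCLM j (hermiteSchwartz (binv F))) = zCLM j (zCLM i (hermiteSchwartz (binv F))) := by
  rw [zCLM_zCLM_binv, zCLM_zCLM_binv, pderiv_pderiv_comm]

end CCR

/-! ## §3  The three quadratic letters in Folland's normalisation -/

section Letters

/-- **The compact letter `𝔨_{ij} := π Z_i^* Z_j + ½ δ_{ij}`** on `𝓢(ℝ^σ, ℂ)` — the generators of `𝔲(n)` in the
oscillator representation; the diagonal ones generate the torus. [cite: Folland1989, §4.4] -/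
def kLetterCLM (i j : σ) : 𝓢(EuclideanSpace ℝ σ, ℂ) →L[ℂ] 𝓢(EuclideanSpace ℝ σ, ℂ) :=
  (π : ℂ) • (zsCLM i).comp (zCLM j) +
    (if i = j then (1 / 2 : ℂ) • ContinuousLinearMap.id ℂ _ else 0)

/-- **The raising letter `𝔭⁺_{ij} := Z_i^* Z_j^*`** on `𝓢(ℝ^σ, ℂ)`. [cite: Folland1989, §4.4] -/
def pPlusLetterCLM (i j : σ) : 𝓢(EuclideanSpace ℝ σ, ℂ) →L[ℂ] 𝓢(EuclideanSpace ℝ σ, ℂ) :=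
  (zsCLM i).comp (zsCLM j)

/-- **The lowering letter `𝔭⁻_{ij} := π² Z_i Z_j`** on `𝓢(ℝ^σ, ℂ)`. [cite: Folland1989, §4.4] -/
def pMinusLetterCLM (i j : σ) : 𝓢(EuclideanSpace ℝ σ, ℂ) →L[ℂ] 𝓢(EuclideanSpace ℝ σ, ℂ) :=
  ((π : ℂ) * (π : ℂ)) • (zCLM i).comp (zCLM j)

/-- **`𝔨_{ij} ↔ z_i ∂_j + ½δ_{ij}`**: `kLetterCLM i j (B⁻¹F) = B⁻¹(z_i ∂_jF + ½δ_{ij}F)`. [cite: Folland1989, §1.7] -/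
theorem kLetterCLM_binv (i j : σ) (F : MvPolynomial σ ℂ) :
    kLetterCLM i j (hermiteSchwartz (binv F)) =
      hermiteSchwartz (binv (X i * pderiv j F + if i = j then (1 / 2 : ℂ) • F else 0)) := by
  have h1 : kLetterCLM i j (hermiteSchwartz (binv F)) =
      (π : ℂ) • zsCLM i (zCLM j (hermiteSchwartz (binv F))) +
        (if i = j then (1 / 2 : ℂ) • ContinuousLinearMap.id ℂ _ else (0 : _ →L[ℂ] _)) (hermiteSchwartz (binv F)) :=
    rfl
  rw [h1, zsCLM_zCLM_binv', smul_smul, mul_inv_cancel₀ (Complex.ofReal_ne_zero.mpr Real.pi_ne_zero), one_smul, map_add, hermiteSchwartz_add]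
  congr 1
  split_ifs with h
  · rw [map_smul, hermiteSchwartz_smul]; rfl
  · rw [map_zero]
    ext x
    rw [hermiteSchwartz_apply]
    simp [hermiteFun]

/-- **`𝔭⁺_{ij} ↔ z_i z_j`**: `pPlusLetterCLM i j (B⁻¹F) = B⁻¹(z_i z_j F)`. [cite: Folland1989, §1.7] -/
theorem pPlusLetterCLM_binv (i j : σ) (F : MvPolynomial σ ℂ) :
    pPlusLetterCLM i j (hermiteSchwartz (binv F)) = hermiteSchwartz (binv (X i * (X j * F))) :=
  zsCLM_zsCLM_binv i j F

/-- **`𝔭⁻_{ij} ↔ ∂_i ∂_j`**: `pMinusLetterCLM i j (B⁻¹F) = B⁻¹(∂_i∂_jF)`. [cite: Folland1989, §1.7] -/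
theorem pMinusLetterCLM_binv (i j : σ) (F : MvPolynomial σ ℂ) :
    pMinusLetterCLM i j (hermiteSchwartz (binv F)) = hermiteSchwartz (binv (pderiv i (pderiv j F))) := by
  have h1 : pMinusLetterCLM i j (hermiteSchwartz (binv F)) =
      ((π : ℂ) * (π : ℂ)) • zCLM i (zCLM j (hermiteSchwartz (binv F))) := rfl
  rw [h1, zCLM_zCLM_binv, smul_smul, show (π : ℂ) * (π : ℂ) * ((π : ℂ)⁻¹ * (π : ℂ)⁻¹) = 1 by
    field_simp, one_smul]

/-- **The diagonal compact letter is half the Hermite operator on the Hermite span**: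
`kLetterCLM j j (hermiteSchwartz p) = ½ · 2π(D_j² + X_j²)(hermiteSchwartz p)` — so the torus generators of the
oscillator representation are the harmonic-oscillator Hamiltonians (Folland §1.7 (vi): `πZ_j^*Z_j + ½ = π(D_j²+X_j²)`).
[cite: Folland1989, §1.7] -/
theorem kLetterCLM_self_hermiteSchwartz (j : σ) (p : MvPolynomial σ ℂ) :
    kLetterCLM j j (hermiteSchwartz p) = (1 / 2 : ℂ) • hermiteOpCLM j (hermiteSchwartz p) := by
  have h1 : kLetterCLM j j (hermiteSchwartz p) =
      (π : ℂ) • zsCLM j (zCLM j (hermiteSchwartz p)) +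
        (if j = j then (1 / 2 : ℂ) • ContinuousLinearMap.id ℂ _ else (0 : _ →L[ℂ] _)) (hermiteSchwartz p) := rfl
  rw [h1, if_pos rfl, hermiteOpCLM_eq_ladder_hermiteSchwartz, smul_add, smul_smul]
  congr 1
  congr 1
  rw [one_div, ← mul_assoc, show ((2 : ℂ)⁻¹ * 2) = 1 by norm_num, one_mul]

/-- **The diagonal compact letter on the Hermite functions**: `kLetterCLM j j h_α = (α_j + ½) h_α` — the torus
weight of `h_α` in the `j`-th coordinate direction is `α_j + ½` (the `½` is the per-coordinate ground-state energy).
[cite: Folland1989, Thm 1.83] -/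
theorem kLetterCLM_self_herm (j : σ) (α : σ →₀ ℕ) :
    kLetterCLM j j (hermiteSchwartz (herm α)) = ((α j : ℂ) + 1 / 2) • hermiteSchwartz (herm α) := by
  rw [kLetterCLM_self_hermiteSchwartz, hermiteOpCLM_herm, smul_smul, show (1 / 2 : ℂ) * (2 * (α j : ℂ) + 1) =
    (α j : ℂ) + 1 / 2 by ring]

end Letters

end Literature.Analysis.SegalBargmann

end
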